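import Mathlib
import Summits.Ventures.HodgeRepro.Tier4.Line1.RTFSetting

/-!
# Tier4/Line1/RtfGeometric — LINE L1, lemma L1.1 `rtf_geometric`: the GEOMETRIC expansion of `J(f)`

Blind re-derivation cell `pub-hodge-repro`, Tier 4 «prove the step» (README §9–§10), seat t4-L1-p2 (prover, gen 0),
against LINE L1 (t4-plan-1, Skeleton.lean v0.8 «LINE L1 FILED 12c8528bc811170c…bb43 949», lead S12152); assignment
S12132: t4-L1-p2 = L1.1 `rtf_geometric` (M).  The statement is BYTE-IDENTICAL to Skeleton.lean v0.8 L406–L409 and is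
proved here SORRY-FREE from `RTFSetting` (Part I of the line, p661834) and Mathlib alone.  Paper proof:
proofs/t4/L1/L1.1-rtf_geometric.md.

THE LEMMA.  Over any `RTF.Setting G` and for `χ`, `χ'` continuous unitary characters and `f` a test function,
`J(f) = ∫_{DT} ∫_{DT'} K_f(t, t') χ(t) conj χ'(t') = ∑ᶠ o, O_o(f)` — the relative-trace-formula distribution is the
(finite) sum over the rational double cosets `o ∈ T(k)\G(k)/T'(k)` of the orbital terms
`O_o(f) = ∫_{DT} ∫_{DT'} K_f^o(t, t') χ(t) conj χ'(t')`, `K_f^o` the partial kernel of `o`.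

THE PROOF (four steps, every one a DEFINED Mathlib statement; no first-countability / second-countability of `G`
is assumed anywhere — the generic `Setting` has none):
* (i) FINITENESS.  `Γ := {γ ∈ G(k) : f(t⁻¹ γ t') ≠ 0 for some t ∈ closure DT, t' ∈ closure DT'}` is finite: such a `γ`
  lies in the compact set `closure DT · tsupport f · (closure DT')⁻¹` (`IsCompact.mul`, `IsCompact.inv`), and `G(k)`
  is closed (`S.closed`) and discrete (`S.discrete`), so `G(k) ∩ compact` is compact and discrete, hence finite
  (`IsCompact.finite`).  [`finite_support_closure`]
* (ii) FINITE SUMS.  On `closure DT × closure DT'` the kernel `K_f = ∑' γ` is the finite sum over `Γ` (`tsum_eq_sum`), each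
  partial kernel the finite sum over its fibre `Γ_o = {γ ∈ Γ : orbitOf γ = o}`, so `K_f = ∑_{o ∈ O} K_f^o` pointwise
  there with `O := orbitOf '' Γ` (`Finset.sum_fiberwise_of_maps_to`).
* (iii) THE FINSUM.  Orbits outside `O` contribute `0` (`orbital_eq_zero_of_not_mem`), so `∑ᶠ o, O_o(f) = ∑_{o ∈ O} O_o(f)`
  (`finsum_eq_sum_of_support_subset`).
* (iv) EXCHANGE.  Finite sum ⇄ the two set integrals (`integral_finsetSum`) needs the INTEGRABILITY of every orbital
  integrand.  Inner: on `closure DT'` (compact) the integrand `t' ↦ K_f^o(t, t') χ(t) conj χ'(t')` agrees with a continuous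
  function (the finite sum of (ii)), so it is integrable on `DT'` (`ContinuousOn.integrableOn_compact'`, Haar is finite on
  compacts).  Outer: `t ↦ ∫_{DT'} (finite sum) χ(t) conj χ'(t')` is CONTINUOUS on `T` by the TUBE LEMMA
  (`IsCompact.eventually_forall_of_forall_eventually`; Mathlib's `continuous_parametric_integral_of_continuous` asks
  `FirstCountableTopology` of the parameter space, which a generic topological group need not have), agrees with the true
  outer integrand on `closure DT`, hence is integrable on `DT`.  [`Geometric.continuous_setIntegral_of_continuous_uncurry`,
  `Geometric.setIntegral_congr_of_eqOn_closure`]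

Setting fields used: `haarT`, `haarT'` (finiteness on compacts), `compT`, `compT'`, `discrete`, `closed`; hypotheses used:
`hf.cont`, `hf.compact`, `hχ.cont`, `hχ'.cont` (the unitarity and rationality of the characters are NOT needed for this
lemma).  `#print axioms rtf_geometric` = [propext, Classical.choice, Quot.sound].

Nothing here says anything about the status of the Hodge conjecture for CM abelian varieties, which is NOT proved
(HC_CM is NOT proved by anyone in this repository).
-/

/-! ## L1.1 — the geometric expansion `J(f) = ∑ᶠ o, O_o(f)` (t4-L1-p2) -/

set_option autoImplicit false

noncomputable section

namespace Summit.Ventures.HodgeRepro.Tier4.Line1.RTF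

open MeasureTheory Topology Filter Set
open scoped Pointwise

namespace Geometric

/-- A parametric set integral `x ↦ ∫_{s} F x y dμ(y)` of a JOINTLY continuous integrand over a relatively
compact set `s` is continuous in the parameter.  Proved by the tube lemma
(`IsCompact.eventually_forall_of_forall_eventually`), so NO first-countability of the parameter space is
needed (Mathlib's `continuous_parametric_integral_of_continuous` asks `FirstCountableTopology`, which the
generic `Setting` does not supply). -/
theorem continuous_setIntegral_of_continuous_uncurry {X Y : Type*} [TopologicalSpace X]
    [TopologicalSpace Y] [MeasurableSpace Y] [OpensMeasurableSpace Y]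
    {μ : Measure Y} [IsFiniteMeasureOnCompacts μ] {s : Set Y} (hs : IsCompact (closure s))
    {F : X → Y → ℂ} (hF : Continuous (Function.uncurry F)) :
    Continuous fun x => ∫ y in s, F x y ∂μ := by
  have hint : ∀ x, IntegrableOn (F x) s μ := fun x => by
    have hc : Continuous (F x) := hF.uncurry_left x
    exact (hc.continuousOn.integrableOn_compact' hs isClosed_closure.measurableSet).mono_set
      subset_closure
  rw [continuous_iff_continuousAt]
  intro x₀
  rw [Metric.continuousAt_iff']
  intro ε hε
  have hm0 : 0 ≤ μ.real (closure s) := ENNReal.toReal_nonneg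
  have hδpos : 0 < ε / (μ.real (closure s) + 1) := div_pos hε (by linarith)
  have key : ∀ᶠ x in 𝓝 x₀, ∀ y ∈ closure s, ‖F x y - F x₀ y‖ < ε / (μ.real (closure s) + 1) := by
    apply hs.eventually_forall_of_forall_eventually
    intro y _
    have hc : Continuous fun z : X × Y => ‖F z.1 z.2 - F x₀ z.2‖ := by
      apply Continuous.norm
      exact hF.sub (hF.comp (continuous_const.prodMk continuous_snd))
    have h0 : Tendsto (fun z : X × Y => ‖F z.1 z.2 - F x₀ z.2‖) (𝓝 (x₀, y)) (𝓝 0) := by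
      simpa using hc.tendsto (x₀, y)
    exact h0.eventually (gt_mem_nhds hδpos)
  filter_upwards [key] with x hx
  rw [dist_eq_norm, ← integral_sub (hint x) (hint x₀)]
  have hb : ‖∫ y in s, (F x y - F x₀ y) ∂μ‖ ≤ ε / (μ.real (closure s) + 1) * μ.real s :=
    norm_setIntegral_le_of_norm_le_const
      ((measure_mono subset_closure).trans_lt hs.measure_lt_top)
      (fun y hy => (hx y (subset_closure hy)).le)
  have hmono : μ.real s ≤ μ.real (closure s) :=
    ENNReal.toReal_mono hs.measure_ne_top (measure_mono subset_closure)
  calc ‖∫ y in s, (F x y - F x₀ y) ∂μ‖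
      ≤ ε / (μ.real (closure s) + 1) * μ.real s := hb
    _ ≤ ε / (μ.real (closure s) + 1) * μ.real (closure s) :=
        mul_le_mul_of_nonneg_left hmono hδpos.le
    _ < ε := by
        rw [div_mul_eq_mul_div, div_lt_iff₀ (by linarith)]
        nlinarith

/-- Two integrands that agree on the closure of `s` have the same integral over `s`. -/
theorem setIntegral_congr_of_eqOn_closure {Y : Type*} [TopologicalSpace Y] [MeasurableSpace Y]
    [OpensMeasurableSpace Y] {μ : Measure Y} {s : Set Y} {g h : Y → ℂ}
    (hgh : Set.EqOn g h (closure s)) : ∫ y in s, g y ∂μ = ∫ y in s, h y ∂μ := by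
  apply integral_congr_ae
  apply ae_restrict_of_ae_restrict_of_subset subset_closure
  rw [ae_restrict_iff' isClosed_closure.measurableSet]
  exact Filter.Eventually.of_forall fun y hy => hgh hy

end Geometric

variable {G : Type} [Group G] [TopologicalSpace G] [IsTopologicalGroup G] [MeasurableSpace G]
  [BorelSpace G]

namespace Setting

variable (S : Setting G)

omit [BorelSpace G] in
/-- UNIFORM finiteness on the closures of the domains (the form L1.1 consumes; it is the special case
`C₁ = closure DT`, `C₂ = closure DT'` of p1's `kernel_support_finite_uniform`, re-proved here so that this module
depends on `RTFSetting` alone): the rational `γ` with `f(t⁻¹ γ t') ≠ 0` for some `t ∈ closure DT`,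
`t' ∈ closure DT'` lie in the compact set `closure DT · tsupport f · (closure DT')⁻¹`, and `G(k)` is closed and
discrete, so they are finitely many. -/
theorem finite_support_closure {f : G → ℂ} (hf : IsTest f) :
    {γ : S.Gk | ∃ t ∈ closure S.DT, ∃ t' ∈ closure S.DT', f ((t : G)⁻¹ * γ * t') ≠ 0}.Finite := by
  have hA : IsCompact ((fun t : S.T => (t : G)) '' closure S.DT) :=
    S.compT.image continuous_subtype_val
  have hB : IsCompact ((fun t : S.T' => (t : G)) '' closure S.DT') :=
    S.compT'.image continuous_subtype_val
  have hK : IsCompact (tsupport f) := hf.compact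
  have hC : IsCompact (((fun t : S.T => (t : G)) '' closure S.DT) * tsupport f *
      ((fun t : S.T' => (t : G)) '' closure S.DT')⁻¹) := (hA.mul hK).mul hB.inv
  have hfin : ((S.Gk : Set G) ∩ (((fun t : S.T => (t : G)) '' closure S.DT) * tsupport f *
      ((fun t : S.T' => (t : G)) '' closure S.DT')⁻¹)).Finite :=
    (hC.inter_left S.closed).finite
      ((SetLike.isDiscrete_iff_discreteTopology.2 S.discrete).mono inter_subset_left)
  refine Set.Finite.of_finite_image (f := fun γ : S.Gk => (γ : G)) (hfin.subset ?_)
    (Set.injOn_of_injective Subtype.val_injective)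
  rintro _ ⟨γ, ⟨t, ht, t', ht', hne⟩, rfl⟩
  refine ⟨γ.2, ?_⟩
  have hmem : (t : G)⁻¹ * γ * t' ∈ tsupport f := subset_tsupport _ hne
  have hγ : (γ : G) = (t : G) * ((t : G)⁻¹ * γ * t') * ((t' : G))⁻¹ := by group
  change (γ : G) ∈ _
  rw [hγ]
  exact Set.mul_mem_mul (Set.mul_mem_mul ⟨t, ht, rfl⟩ hmem) (Set.inv_mem_inv.2 ⟨t', ht', rfl⟩)

/-- L1.1 (M): the geometric expansion `J(f) = ∑_{[γ]} O_{[γ]}(f)` (a finite sum by L1.0′; the kernel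
is the sum of the partial kernels, Fubini on the compact domain). -/
theorem rtf_geometric {χ : S.T → ℂ} {χ' : S.T' → ℂ} (hχ : S.IsCharacter χ) (hχ' : S.IsCharacter' χ')
    {f : G → ℂ} (hf : IsTest f) : S.J χ χ' f = ∑ᶠ o, S.orbital χ χ' o f := by
  classical
  haveI : IsFiniteMeasureOnCompacts S.μT := S.haarT.toIsFiniteMeasureOnCompacts
  haveI : IsFiniteMeasureOnCompacts S.μT' := S.haarT'.toIsFiniteMeasureOnCompacts
  -- (i) the finite set `Γ` of contributing rational points
  obtain ⟨Γ, hΓ⟩ : ∃ Γ : Finset S.Gk, ∀ γ : S.Gk, γ ∉ Γ → ∀ t ∈ closure S.DT,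
      ∀ t' ∈ closure S.DT', f ((t : G)⁻¹ * γ * t') = 0 := by
    refine ⟨(S.finite_support_closure hf).toFinset, fun γ hγ t ht t' ht' => ?_⟩
    by_contra hne
    exact hγ ((S.finite_support_closure hf).mem_toFinset.2 ⟨t, ht, t', ht', hne⟩)
  -- the finite set `O` of contributing orbits
  set O : Finset S.Orbit := Γ.image S.orbitOf with hO
  -- (ii) on `closure DT × closure DT'` the kernel is the finite sum over `Γ`, each partial kernel the
  -- finite sum over its fibre
  have hker : ∀ t ∈ closure S.DT, ∀ t' ∈ closure S.DT',
      S.kernel f t t' = ∑ γ ∈ Γ, f ((t : G)⁻¹ * γ * t') := fun t ht t' ht' =>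
    tsum_eq_sum (fun γ hγ => hΓ γ hγ t ht t' ht')
  have hpk : ∀ o, ∀ t ∈ closure S.DT, ∀ t' ∈ closure S.DT',
      S.partialKernel o f t t' = ∑ γ ∈ Γ with S.orbitOf γ = o, f ((t : G)⁻¹ * γ * t') := by
    intro o t ht t' ht'
    unfold partialKernel
    rw [tsum_eq_sum (s := Γ.subtype (fun γ => S.orbitOf γ = o))]
    · exact Finset.sum_subtype_eq_sum_filter (fun γ : S.Gk => f ((t : G)⁻¹ * γ * t'))
    · intro γ hγ
      rw [Finset.mem_subtype] at hγ
      exact hΓ γ.1 hγ t ht t' ht'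
  have hsum : ∀ t ∈ closure S.DT, ∀ t' ∈ closure S.DT',
      S.kernel f t t' = ∑ o ∈ O, S.partialKernel o f t t' := by
    intro t ht t' ht'
    rw [hker t ht t' ht', ← Finset.sum_fiberwise_of_maps_to (g := S.orbitOf) (t := O)
      (fun γ hγ => Finset.mem_image_of_mem _ hγ)]
    exact Finset.sum_congr rfl (fun o _ => (hpk o t ht t' ht').symm)
  -- (iii) the `finsum` is the finite sum over `O`
  have hfin : ∑ᶠ o, S.orbital χ χ' o f = ∑ o ∈ O, S.orbital χ χ' o f := by
    apply finsum_eq_sum_of_support_subset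
    intro o ho
    rw [Function.mem_support] at ho
    by_contra hoO
    apply ho
    apply S.orbital_eq_zero_of_not_mem
    rintro ⟨t, ht, t', ht', γ, rfl, hne⟩
    apply hoO
    apply Finset.mem_image_of_mem
    by_contra hγ
    exact hne (hΓ γ hγ t (subset_closure ht) t' (subset_closure ht'))
  rw [hfin]
  -- (iv) the continuous models of the integrands
  have hcont : ∀ γ : S.Gk, Continuous fun p : S.T × S.T' => f ((p.1 : G)⁻¹ * γ * p.2) := fun γ =>
    hf.cont.comp (((continuous_subtype_val.comp continuous_fst).inv.mul continuous_const).mul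
      (continuous_subtype_val.comp continuous_snd))
  have hF : ∀ o, Continuous (Function.uncurry fun (t : S.T) (t' : S.T') =>
      (∑ γ ∈ Γ with S.orbitOf γ = o, f ((t : G)⁻¹ * γ * t')) * χ t * starRingEnd ℂ (χ' t')) := by
    intro o
    apply Continuous.mul
    · apply Continuous.mul
      · exact continuous_finsetSum _ (fun γ _ => hcont γ)
      · exact hχ.cont.comp continuous_fst
    · exact (continuous_star : Continuous (starRingEnd ℂ)).comp (hχ'.cont.comp continuous_snd)
  -- inner integrability and the inner exchange
  have hinner : ∀ o, ∀ t ∈ closure S.DT, IntegrableOn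
      (fun t' : S.T' => S.partialKernel o f t t' * χ t * starRingEnd ℂ (χ' t')) S.DT' S.μT' := by
    intro o t ht
    have hc : Continuous fun t' : S.T' =>
        (∑ γ ∈ Γ with S.orbitOf γ = o, f ((t : G)⁻¹ * γ * t')) * χ t * starRingEnd ℂ (χ' t') :=
      (hF o).uncurry_left t
    refine ((hc.continuousOn.integrableOn_compact' S.compT' isClosed_closure.measurableSet).congr_fun
      ?_ isClosed_closure.measurableSet).mono_set subset_closure
    intro t' ht'
    simp only [hpk o t ht t' ht']
  have hinnerEq : ∀ t ∈ closure S.DT,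
      ∫ t' in S.DT', S.kernel f t t' * χ t * starRingEnd ℂ (χ' t') ∂S.μT' =
        ∑ o ∈ O, ∫ t' in S.DT', S.partialKernel o f t t' * χ t * starRingEnd ℂ (χ' t') ∂S.μT' := by
    intro t ht
    rw [← integral_finsetSum O (fun o _ => hinner o t ht)]
    apply Geometric.setIntegral_congr_of_eqOn_closure
    intro t' ht'
    simp only [hsum t ht t' ht', Finset.sum_mul]
  -- outer integrability
  have houter : ∀ o, IntegrableOn (fun t : S.T =>
      ∫ t' in S.DT', S.partialKernel o f t t' * χ t * starRingEnd ℂ (χ' t') ∂S.μT') S.DT S.μT := by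
    intro o
    have hc : Continuous fun t : S.T => ∫ t' in S.DT',
        (∑ γ ∈ Γ with S.orbitOf γ = o, f ((t : G)⁻¹ * γ * t')) * χ t * starRingEnd ℂ (χ' t') ∂S.μT' :=
      Geometric.continuous_setIntegral_of_continuous_uncurry S.compT' (hF o)
    refine ((hc.continuousOn.integrableOn_compact' S.compT isClosed_closure.measurableSet).congr_fun
      ?_ isClosed_closure.measurableSet).mono_set subset_closure
    intro t ht
    apply Geometric.setIntegral_congr_of_eqOn_closure
    intro t' ht'
    simp only [hpk o t ht t' ht']
  -- (v) assemble
  unfold J orbital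
  rw [← integral_finsetSum O (fun o _ => houter o)]
  apply Geometric.setIntegral_congr_of_eqOn_closure
  intro t ht
  exact hinnerEq t ht

end Setting

end Summit.Ventures.HodgeRepro.Tier4.Line1.RTF

end
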